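import Summits.QuantumFields.BalabanUV.Beta.D1BFx.ColourVectorLift

/-!
# `BalabanUV.Beta.D1BFx.ColourLiftAdE3` — road «BF-x» for binder row D1, slot (K), chain step (I) «(A1)-PACKED», brick **«AD-E3-LIFT»** PART B
# (owner ruling ρ-g16-1′, journal [D1P2-G16-WORDS-4]): THE HONEST ONE-GENERATOR COLOUR `c₃ = ad e₃` ON `Fin 3` — antisymmetric, traceless,
# `tr c₃² = −2` (the same stripping constant as `ColourLift.cgen`), AND `c₃ e₃ = 0` (which `cgen` on `Fin 2`, being invertible, cannot offer) — and
# the `e₃`-instances of PART A (`ColourVectorLift`): the EVEN packed tuple's colourless Ward letters DERIVED, no odd part, no `R`, nothing displayed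
# beyond the lifted table-level letters

HONEST DEPENDENCY (cell records, verbatim): «continuum YM on T⁴ ⇐ BetaPertH ∧ nine spine estimates (0/9 proved); BetaPertH ⇐ (D1) ∧ (D4) ∧
CAP+tail; G-an2-4 gates asym, D1 and NE2/3/4.»  HONEST FRAMING (cell contract, verbatim): «discharging `BetaPertH` makes Bałaban's UV stability
UNCONDITIONAL — a real constructive-QFT result; it is NOT the continuum limit and NOT the Clay problem.»  THIS MODULE DISCHARGES NOTHING of (K),
of D1 or of the wall: [folklore] `Fin 3` arithmetic (Mathlib) + PART A BY NAME.  [our object] data: `c₃`, `e₃` (two explicit `Fin 3` arrays, plain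
abbreviations asserting nothing).  No `def … : Prop`, nothing cited, 0 sorry.  The colour model is the road's MODEL decision (ρ-g16-1′), recorded
in `Q-A1P-1-ANSWER.md` §DIAGNOSIS and the owner's CHECK-N0 N0(f); it instantiates NO table of the cell.  NOT D1, NOT BetaPertH, NOT continuum, NOT Clay.

ABSOLUTE RULE (cell charter, verbatim): «No internally-minted statement may enter as a cited fact. Every hypothesis is either kernel-proved in this
package or a verbatim quotation of a PUBLISHED theorem with page reference. The manuscript(s) under audit are NOT citable for their own disputed
steps — they are the thing under adjudication; programme-internal (2001/route/tribunal) claims are never citable.»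

CONTENT.
* §1 [our object] `c₃ := !![0,−1,0; 1,0,0; 0,0,0]`, `e₃ := ![0,0,1]`; [folklore] `c₃_transpose`, `trace_c₃`, `c₃_mul_c₃`, **`trace_c₃_mul_c₃ = −2`**,
  **`c₃_mulVec_e₃ = 0`**, `c₃_ne_zero`, `c₃_sq_ne_zero`.
* §5 [folklore] the instances of PART A at `l = Fin 3`, `θ = e₃`, ANY colour family with `C 2 = c₃` (e.g. `γ ↦ ad e_γ`): `sum_e₃_smul` (`Σ e₃•C = C 2`),
  `sum_e₃_smul_mulVec_e₃`, **`packedWard₂_even_adE3`** (the EVEN tuple's colourless mixed letter), **`packedWard₁_adE3`** (first order),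
  **`ward₂_even_adE3`** (the `ν ⊕ μ` read-out: `aₛₜ ∧ bₛₜ` of the even packed tuple).
Provenance: D1 formalisation swarm leaf seat `b2b-balaban-beta-d1-formalise-leaf-03` gen 20 (owner ruling ρ-g16-1′ «AD-E3 LIFT», WANTED), 2026-08-22.
-/

noncomputable section

namespace Summit.QuantumFields.BalabanUV.Beta.D1BFx.ColourLiftAdE3

open Matrix
open scoped BigOperators Kronecker
open Summit.QuantumFields.BalabanUV.Beta.D1BFx.WardJetsFromNoether (oslot)
open Literature.MathematicalPhysics.QuantumFieldTheory.Balaban1983to89.Beta.Composition (kkt)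
open Summit.QuantumFields.BalabanUV.Beta.D1BFx.ColourVectorLift (packedWard₂_even_of_lift packedWard₁_of_lift ward₂_even_of_lift)

/-! ## §1 The honest one-generator colour `c₃ = ad e₃` and its kernel vector -/

/-- [our object] `ad e₃` on `ℝ³` (the rotation generator about the third axis): `!![0,−1,0; 1,0,0; 0,0,0]`. -/
def c₃ : Matrix (Fin 3) (Fin 3) ℝ := !![0, -1, 0; 1, 0, 0; 0, 0, 0]

/-- [our object] The colour vector the generator kills: `e₃ = (0,0,1)`. -/
def e₃ : Fin 3 → ℝ := ![0, 0, 1]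

/-- [folklore] `c₃ᵀ = −c₃`. -/
theorem c₃_transpose : c₃ᵀ = -c₃ := by
  ext i j; fin_cases i <;> fin_cases j <;> simp [c₃]

/-- [folklore] `tr c₃ = 0`. -/
theorem trace_c₃ : c₃.trace = 0 := by
  simp [c₃, Matrix.trace, Fin.sum_univ_three]

/-- [folklore] `c₃·c₃ = −diag(1,1,0)`. -/
theorem c₃_mul_c₃ : c₃ * c₃ = !![-1, 0, 0; 0, -1, 0; 0, 0, 0] := by
  ext i j; fin_cases i <;> fin_cases j <;> simp [c₃, Matrix.mul_apply, Fin.sum_univ_three]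

/-- [folklore] `tr (c₃·c₃) = −2` — the SAME stripping constant as `ColourLift.trace_cgen_mul_cgen`. -/
theorem trace_c₃_mul_c₃ : (c₃ * c₃).trace = -2 := by
  rw [c₃_mul_c₃]; simp [Matrix.trace, Fin.sum_univ_three]; norm_num

/-- [folklore] **THE POINT OF THE MODEL: the generator KILLS its own colour vector**, `c₃ e₃ = 0` (`ad(θ)θ = 0`). -/
theorem c₃_mulVec_e₃ : c₃ *ᵥ e₃ = 0 := by
  ext i; fin_cases i <;> simp [c₃, e₃, Matrix.mulVec, dotProduct, Fin.sum_univ_three]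

/-- [folklore] `c₃ ≠ 0`. -/
theorem c₃_ne_zero : c₃ ≠ 0 := by
  intro h; have := congrFun (congrFun h 1) 0; simp [c₃] at this

/-- [folklore] `c₃·c₃ ≠ 0`. -/
theorem c₃_sq_ne_zero : c₃ * c₃ ≠ 0 := by
  rw [c₃_mul_c₃]; intro h; have := congrFun (congrFun h 0) 0; simp at this

/-! ## §5 The `ad e₃` instance -/

section AdE3

variable {σ ρ' : Type*} [Fintype σ]

/-- [folklore] With weights along `e₃`, a colour family enters only through its third member: `Σ (e₃)_γ • C γ = C 2`. -/
theorem sum_e₃_smul (C : Fin 3 → Matrix (Fin 3) (Fin 3) ℝ) : ∑ γ, e₃ γ • C γ = C 2 := by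
  simp [e₃, Fin.sum_univ_three]

/-- [folklore] For a colour family whose third member is `c₃` (e.g. `ad e_γ`): `(Σ e₃•C) e₃ = c₃ e₃ = 0`. -/
theorem sum_e₃_smul_mulVec_e₃ (C : Fin 3 → Matrix (Fin 3) (Fin 3) ℝ) (hC : C 2 = c₃) : (∑ γ, e₃ γ • C γ) *ᵥ e₃ = 0 := by
  rw [sum_e₃_smul, hC, c₃_mulVec_e₃]

/-- [folklore] **THE EVEN TUPLE's COLOURLESS MIXED LETTER IN THE `ad e₃` MODEL** — `packedWard₂_even_of_lift` at `l = Fin 3`, `θ = e₃`, any colour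
family with `C 2 = c₃` (`C_θ = c₃`, `c₃·c₃ ≠ 0`). -/
theorem packedWard₂_even_adE3 (C : Fin 3 → Matrix (Fin 3) (Fin 3) ℝ) (hC : C 2 = c₃)
    (𝕄₀ : Matrix σ σ ℝ) (𝕄₁ : σ → Matrix σ σ ℝ) (𝕄₂ : σ → σ → Matrix σ σ ℝ) (Ŵ₀ : Matrix σ ρ' ℝ) (X₁ : σ → Matrix σ ρ' ℝ)
    (X₂ : σ → σ → Matrix σ ρ' ℝ)
    (hP1 : ∀ p : Fin 3 × σ, (C p.1 ⊗ₖ 𝕄₁ p.2) * ((1 : Matrix (Fin 3) (Fin 3) ℝ) ⊗ₖ Ŵ₀) + ((1 : Matrix (Fin 3) (Fin 3) ℝ) ⊗ₖ 𝕄₀) * (C p.1 ⊗ₖ X₁ p.2)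
      + oslot (fun q : Fin 3 × σ => C q.1 ⊗ₖ X₁ q.2) (fun i => ((1 : Matrix (Fin 3) (Fin 3) ℝ) ⊗ₖ 𝕄₀) i p) = 0)
    (hP2 : ∀ p q : Fin 3 × σ, ((C p.1 * C q.1) ⊗ₖ 𝕄₂ p.2 q.2) * ((1 : Matrix (Fin 3) (Fin 3) ℝ) ⊗ₖ Ŵ₀) + (C p.1 ⊗ₖ 𝕄₁ p.2) * (C q.1 ⊗ₖ X₁ q.2)
      + (C q.1 ⊗ₖ 𝕄₁ q.2) * (C p.1 ⊗ₖ X₁ p.2) + ((1 : Matrix (Fin 3) (Fin 3) ℝ) ⊗ₖ 𝕄₀) * ((C p.1 * C q.1) ⊗ₖ X₂ p.2 q.2)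
      + oslot (fun q' : Fin 3 × σ => C q'.1 ⊗ₖ X₁ q'.2) (fun i => (C q.1 ⊗ₖ 𝕄₁ q.2) i p)
      + oslot (fun q' : Fin 3 × σ => (C q.1 * C q'.1) ⊗ₖ X₂ q.2 q'.2) (fun i => ((1 : Matrix (Fin 3) (Fin 3) ℝ) ⊗ₖ 𝕄₀) i p)
      + oslot (fun p' : Fin 3 × σ => (C p.1 * C p'.1) ⊗ₖ X₂ p.2 p'.2) (fun i => ((1 : Matrix (Fin 3) (Fin 3) ℝ) ⊗ₖ 𝕄₀) i q) = 0)
    (rs rt : σ → ℝ)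
    (hs₂ : ∀ q : Fin 3 × σ, oslot (fun q' : Fin 3 × σ => (C q.1 * C q'.1) ⊗ₖ X₂ q.2 q'.2)
      (((1 : Matrix (Fin 3) (Fin 3) ℝ) ⊗ₖ 𝕄₀) *ᵥ fun p : Fin 3 × σ => e₃ p.1 * rs p.2) = 0)
    (ht₂ : ∀ p : Fin 3 × σ, oslot (fun p' : Fin 3 × σ => (C p.1 * C p'.1) ⊗ₖ X₂ p.2 p'.2)
      (((1 : Matrix (Fin 3) (Fin 3) ℝ) ⊗ₖ 𝕄₀) *ᵥ fun q : Fin 3 × σ => e₃ q.1 * rt q.2) = 0) :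
    (∑ k, ∑ l', (rs k * rt l') • 𝕄₂ k l') * Ŵ₀ + (∑ k, rs k • 𝕄₁ k) * (∑ k, rt k • X₁ k) + (∑ k, rt k • 𝕄₁ k) * (∑ k, rs k • X₁ k)
      + 𝕄₀ * (∑ k, ∑ l', (rs k * rt l') • X₂ k l') = 0 :=
  packedWard₂_even_of_lift C e₃ (sum_e₃_smul_mulVec_e₃ C hC) (by rw [sum_e₃_smul, hC]; exact c₃_sq_ne_zero) 𝕄₀ 𝕄₁ 𝕄₂ Ŵ₀ X₁ X₂ hP1 hP2 rs rt hs₂ ht₂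

/-- [folklore] **FIRST ORDER IN THE `ad e₃` MODEL**: `kₛ·Ŵ₀ + 𝕄₀·wₛ = 0`. -/
theorem packedWard₁_adE3 (C : Fin 3 → Matrix (Fin 3) (Fin 3) ℝ) (hC : C 2 = c₃)
    (𝕄₀ : Matrix σ σ ℝ) (𝕄₁ : σ → Matrix σ σ ℝ) (Ŵ₀ : Matrix σ ρ' ℝ) (X₁ : σ → Matrix σ ρ' ℝ)
    (hP1 : ∀ p : Fin 3 × σ, (C p.1 ⊗ₖ 𝕄₁ p.2) * ((1 : Matrix (Fin 3) (Fin 3) ℝ) ⊗ₖ Ŵ₀) + ((1 : Matrix (Fin 3) (Fin 3) ℝ) ⊗ₖ 𝕄₀) * (C p.1 ⊗ₖ X₁ p.2)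
      + oslot (fun q : Fin 3 × σ => C q.1 ⊗ₖ X₁ q.2) (fun i => ((1 : Matrix (Fin 3) (Fin 3) ℝ) ⊗ₖ 𝕄₀) i p) = 0)
    (r : σ → ℝ)
    (hsrc : oslot (fun q : Fin 3 × σ => C q.1 ⊗ₖ X₁ q.2) (((1 : Matrix (Fin 3) (Fin 3) ℝ) ⊗ₖ 𝕄₀) *ᵥ fun p : Fin 3 × σ => e₃ p.1 * r p.2) = 0) :
    (∑ k, r k • 𝕄₁ k) * Ŵ₀ + 𝕄₀ * (∑ k, r k • X₁ k) = 0 :=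
  packedWard₁_of_lift C e₃ (by rw [sum_e₃_smul, hC]; exact c₃_ne_zero) 𝕄₀ 𝕄₁ Ŵ₀ X₁ hP1 r hsrc

/-- [folklore] **`aₛₜ ∧ bₛₜ` OF THE EVEN PACKED TUPLE IN THE `ad e₃` MODEL** — `ward₂_even_of_lift` at `l = Fin 3`, `θ = e₃`, `C 2 = c₃`. -/
theorem ward₂_even_adE3 {ν μ ρ : Type*} [Fintype ν] [Fintype μ] (C : Fin 3 → Matrix (Fin 3) (Fin 3) ℝ) (hC : C 2 = c₃)
    (K₀ : Matrix ν ν ℝ) (Q₀ : Matrix μ ν ℝ) (K₁ : ν ⊕ μ → Matrix ν ν ℝ) (Q₁ : ν ⊕ μ → Matrix μ ν ℝ)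
    (K₂ : ν ⊕ μ → ν ⊕ μ → Matrix ν ν ℝ) (Q₂ : ν ⊕ μ → ν ⊕ μ → Matrix μ ν ℝ)
    (W₀ : Matrix ν ρ ℝ) (x₁ : ν ⊕ μ → Matrix ν ρ ℝ) (x₂ : ν ⊕ μ → ν ⊕ μ → Matrix ν ρ ℝ)
    (hP1 : ∀ p : Fin 3 × (ν ⊕ μ), (C p.1 ⊗ₖ kkt (K₁ p.2) (Q₁ p.2)) * ((1 : Matrix (Fin 3) (Fin 3) ℝ) ⊗ₖ fromRows W₀ (0 : Matrix μ ρ ℝ))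
      + ((1 : Matrix (Fin 3) (Fin 3) ℝ) ⊗ₖ kkt K₀ Q₀) * (C p.1 ⊗ₖ fromRows (x₁ p.2) (0 : Matrix μ ρ ℝ))
      + oslot (fun q : Fin 3 × (ν ⊕ μ) => C q.1 ⊗ₖ fromRows (x₁ q.2) (0 : Matrix μ ρ ℝ)) (fun i => ((1 : Matrix (Fin 3) (Fin 3) ℝ) ⊗ₖ kkt K₀ Q₀) i p) = 0)
    (hP2 : ∀ p q : Fin 3 × (ν ⊕ μ), ((C p.1 * C q.1) ⊗ₖ kkt (K₂ p.2 q.2) (Q₂ p.2 q.2)) * ((1 : Matrix (Fin 3) (Fin 3) ℝ) ⊗ₖ fromRows W₀ (0 : Matrix μ ρ ℝ))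
      + (C p.1 ⊗ₖ kkt (K₁ p.2) (Q₁ p.2)) * (C q.1 ⊗ₖ fromRows (x₁ q.2) (0 : Matrix μ ρ ℝ))
      + (C q.1 ⊗ₖ kkt (K₁ q.2) (Q₁ q.2)) * (C p.1 ⊗ₖ fromRows (x₁ p.2) (0 : Matrix μ ρ ℝ))
      + ((1 : Matrix (Fin 3) (Fin 3) ℝ) ⊗ₖ kkt K₀ Q₀) * ((C p.1 * C q.1) ⊗ₖ fromRows (x₂ p.2 q.2) (0 : Matrix μ ρ ℝ))
      + oslot (fun q' : Fin 3 × (ν ⊕ μ) => C q'.1 ⊗ₖ fromRows (x₁ q'.2) (0 : Matrix μ ρ ℝ)) (fun i => (C q.1 ⊗ₖ kkt (K₁ q.2) (Q₁ q.2)) i p)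
      + oslot (fun q' : Fin 3 × (ν ⊕ μ) => (C q.1 * C q'.1) ⊗ₖ fromRows (x₂ q.2 q'.2) (0 : Matrix μ ρ ℝ))
          (fun i => ((1 : Matrix (Fin 3) (Fin 3) ℝ) ⊗ₖ kkt K₀ Q₀) i p)
      + oslot (fun p' : Fin 3 × (ν ⊕ μ) => (C p.1 * C p'.1) ⊗ₖ fromRows (x₂ p.2 p'.2) (0 : Matrix μ ρ ℝ))
          (fun i => ((1 : Matrix (Fin 3) (Fin 3) ℝ) ⊗ₖ kkt K₀ Q₀) i q) = 0)
    (rs rt : ν ⊕ μ → ℝ)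
    (hs₂ : ∀ q : Fin 3 × (ν ⊕ μ), oslot (fun q' : Fin 3 × (ν ⊕ μ) => (C q.1 * C q'.1) ⊗ₖ fromRows (x₂ q.2 q'.2) (0 : Matrix μ ρ ℝ))
      (((1 : Matrix (Fin 3) (Fin 3) ℝ) ⊗ₖ kkt K₀ Q₀) *ᵥ fun p : Fin 3 × (ν ⊕ μ) => e₃ p.1 * rs p.2) = 0)
    (ht₂ : ∀ p : Fin 3 × (ν ⊕ μ), oslot (fun p' : Fin 3 × (ν ⊕ μ) => (C p.1 * C p'.1) ⊗ₖ fromRows (x₂ p.2 p'.2) (0 : Matrix μ ρ ℝ))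
      (((1 : Matrix (Fin 3) (Fin 3) ℝ) ⊗ₖ kkt K₀ Q₀) *ᵥ fun q : Fin 3 × (ν ⊕ μ) => e₃ q.1 * rt q.2) = 0) :
    (∑ k, ∑ l', (rs k * rt l') • K₂ k l') * W₀ + (∑ k, rs k • K₁ k) * (∑ k, rt k • x₁ k) + (∑ k, rt k • K₁ k) * (∑ k, rs k • x₁ k)
        + K₀ * (∑ k, ∑ l', (rs k * rt l') • x₂ k l') = 0
    ∧ (∑ k, ∑ l', (rs k * rt l') • Q₂ k l') * W₀ + (∑ k, rs k • Q₁ k) * (∑ k, rt k • x₁ k) + (∑ k, rt k • Q₁ k) * (∑ k, rs k • x₁ k)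
        + Q₀ * (∑ k, ∑ l', (rs k * rt l') • x₂ k l') = 0 :=
  ward₂_even_of_lift C e₃ (sum_e₃_smul_mulVec_e₃ C hC) (by rw [sum_e₃_smul, hC]; exact c₃_sq_ne_zero) K₀ Q₀ K₁ Q₁ K₂ Q₂ W₀ x₁ x₂ hP1 hP2 rs rt hs₂ ht₂

end AdE3

end Summit.QuantumFields.BalabanUV.Beta.D1BFx.ColourLiftAdE3

end
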